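import Literature.MathematicalPhysics.QuantumFieldTheory.Balaban1983to89.B9Eq346AgmonGradientZd
import Literature.MathematicalPhysics.QuantumFieldTheory.Balaban1983to89.B9Thm31GpAgmonDecayFlatCubeZd

/-!
# `Balaban1983to89.B9Thm31GpAgmonGradDecayZd` — [Balaban1985BackgroundPropagators] Thm 3.1 (3.42) p. 397, THE GRADIENT ENTRY `n = 1`, BY AGMON'S METHOD AT THE `ℤᵈ`
# CARRIER: ★★★ `|(∇^η_{U₀}G′(U₀)δ_y w)(x)|_τ ≤ O(1)·(ηLᵐ)·e^{−κL^{−m}|x−y|_∞}·|w|_τ` — print's prefactor `B₀·Lʲη` (one power LESS than the `(Lʲη)²` of the `n = 0` entry)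
# at the coarsest scale, with MEMBER-UNIFORM explicit constants; UNCONDITIONAL at every cube member of [Balaban1985RegularSpaces] (1.131) for the flat background

statement-level skeleton of published theorems with citation tags; proofs where landed; nothing here is a claim about the
Yang–Mills mass gap

`[Balaban1985BackgroundPropagators]` ("B9", CMP **99** (1985) 389–434) Thm 3.1 p. 397, (3.42) p. 397: *«|(∇_U G′(U)λ)(x)| ≤ B₀ Lʲη e^{−δ₀d(y,y′)}|λ| for x ∈ Δ(y),
y ∈ Λ_j, supp λ ⊂ Δ(y′)»* — the SECOND of the four entries `[(Lʲη)², Lʲη, Lʲη, 1]` (`B9.pref4`).  `[Agmon1982]` (Princeton Math. Notes **29**) Thm 1.5 p. 19: the positive-weight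
method.  THIS FILE reads the pointwise covariant gradient of the kernel `G′(U₀)δ_y w` off FILE 9's weighted gradient energy (`B9Eq346AgmonGradientZd.sq_sum_covDerivFwd_GpZd_le`
with the one-site sets `A = {x}`, `B = {y}`): the value `|w|²` enters through ONE inverse mass `M_y⁻¹ ≍ (ηLᵐ)²` (not two), and the unweighting defect `η⁻²(e^{κℓ} − 1)²∕M_{x+e_μ}`
is `O(κ²)` by the scaling slot `η⁻²L^{−2m} ≤ B·M` — so the gradient gains exactly one factor `(ηLᵐ)⁻¹` over the `n = 0` entry, as printed.

CITATION HEADER (lean-in-tree rule).  Cell `pub-ymgap` (YM Track A, HUMAN RULING D-0062 ∕ D-0149 width push), DAG node N06 = [B9], width seat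
`pub-ymgap-dag-n06-w2` (g5), CLAIM-13.  Inputs BY NAME: FILE 9 `sq_sum_covDerivFwd_GpZd_le`; FILE 3 `bondRatio_exp_le ∕ abs_exp_div_exp_sub_one_le ∕ two_eps_eq`;
FILE 4 `window_of_scaling ∕ abs_rho_step_le ∕ abs_rho_sub_rho_le_of_blockMapIter_eq ∕ exp_two_le`; FILE 5 `sum_mass_le_formE_deltaPrimeADom_one_cubeMember`; FILE 8
`sum_ite_eq_of_fullBlockGeometry`; dag-n06-w4's `fullBlockGeometry_cubeMember ∕ cover_cubeLamS`.  Nothing restated.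

WHAT IS PROVED (kernel, 0 sorry, 0 def; no `instance`, no `notation`).
* §1 ★★ `sq_fnorm_covDerivFwd_GpZd_single_le_exp_of_levelCoercive` — generic exponential weight `e^{κ(ρ − ρ(y))}` (`|ρ(z+e_μ) − ρ(z)| ≤ ℓ`, block radii `σ_j`, the window of
  FILE 3): `|(D_μG′δ_y w)(x)|²_τ ≤ e^{2κℓ}e^{−2κ(ρ(x)−ρ(y))}·(2∕((1−θ)²c₀M_y) + 2η⁻²(e^{κℓ}−1)²∕(((1−θ)c₀)²M_{x+e_μ}M_y))·|w|²_τ`.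
* §2 ★★★ `sq_fnorm_covDerivFwd_GpZd_single_le_exp_coarse` ∕ ★★★ `fnorm_covDerivFwd_GpZd_single_le_exp_coarse` — the coarsest-scale edition under the DISPLAYED coercivity
  `hco` and scaling slots `hB`, `hA` (`κ(6dB + 15A) ≤ θc₀`, `0 ≤ κ ≤ 1`, `L ≥ 1`): `|(D_μG′(U₀)δ_y w)(x)|²_τ ≤ 16B(c₀ + 9κ²B)∕((1−θ)c₀)²·(ηLᵐ)²·e^{−2κL^{−m}|x−y|_∞}·|w|²_τ` and
  `|(D_μG′(U₀)δ_y w)(x)|_τ ≤ 4√(B(c₀ + 9κ²B))∕((1−θ)c₀)·(ηLᵐ)·e^{−κL^{−m}|x−y|_∞}·|w|_τ` for `y, x + e_μ ∈ Ω₀`.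
* §3 ★★ `levelData_one_cubeMember` — THE FLAT CUBE-MEMBER DATA PACKAGE (the bookkeeping of FILE 8 made reusable): at a cube member with print-scaled weights there is a site
  mass `M` with `c₀ = 1`, `B = m₈⁻¹`, `A = a_hi m₈⁻¹`, floor `m₈(ηLᵐ)⁻² ≤ M` (`m₈ = min{8, a_lo}`); ★★★ `fnorm_covDerivFwd_GpZd_one_single_le_exp_cubeMember` — UNCONDITIONAL:
  `|(D_μG′(1)δ_y w)(x)|_τ ≤ (10∕√m₈)·(ηLᵐ)·e^{−κL^{−m}|x−y|_∞}·|w|_τ` for `0 ≤ κ ≤ 1`, `κ(12d + 30a_hi) ≤ m₈`, `y, x + e_μ ∈ □₀`.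

HONEST SCOPE.  (i) Single coarsest-scale rate `κL^{−m}` and amplitude `ηLᵐ` — print's multi-scale `Lʲη e^{−δ₀d(y,y′)}` with the scaled distance is NOT here; (ii) the bond
`(x, x+e_μ)` must have its head `x + e_μ` in `Ω₀` (at the Dirichlet collar the covariant difference is `−η⁻¹Φ(x)`, an `n = 0` quantity); (iii) §3 is the FLAT background;
the near-flat class edition is the same two lines on FILE 12's data and is not typed here; (iv) entry `n = 2` (`G′∇*λ`, by the symmetry `formE_GpZd_symm`) and the
sup∕Hölder entries (3.43)–(3.45) are NOT here.  Count-neutral; N05 ∕ N06 NOT discharged; K1⁹ `stmt-QuantumFields-27364` NOT closed; one finite `𝕋⁴` programme at fixed `ε`,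
Bałaban as printed; R4 closes only the conditional finite-`𝕋⁴` rung `BalabanLadder.UV` — nothing continuum ∕ ℝ⁴ ∕ OS ∕ mass gap ∕ Clay.  Unit `pub-ymgap-dag-n06-w2` (g5), 2026-08-28.
-/

noncomputable section

open scoped BigOperators

namespace Literature.MathematicalPhysics.QuantumFieldTheory.Balaban1983to89.B9Thm31GpAgmonGradDecayZd

open B7Prop1Explicit (e)
open B7Prop2Explicit (unitaryUnits)
open B8Ineq132 (covDerivFwd)
open B8Eq119TwistedAxial (bgT bgT_one)
open B8Eq131CubesAdmissible (cubeFam)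
open B8CubeMemberZd (cubeLamS)
open B8LeafModelZd (ZdIdx)
open B8Eq191FlatLettersCubeMember (cubeLamS_finite)
open B9Thm311PosDefOpenZd (cubeMember_Ω0_finite)
open B9Eq319QQStarDiagonalZd (FullBlockGeometry fullBlockGeometry_cubeMember)
open B9Eq321LandauProjectionZd (suppSub formE formE_apply)
open B9Eq324DeltaPrimeAZd (single restrictSite deltaPrimeADom GpZd)
open B9Eq325QprimeSingleSiteZd (blockMapIter)
open B9Eq342CombesThomasFormZd
open B9Eq323ConjugatedLaplacianFormZd (bondRatio)
open B9Thm31GpAgmonDecayZd (bondRatio_exp_le abs_exp_div_exp_sub_one_le two_eps_eq)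
open B9Thm31GpAgmonDecayCoarseZd (window_of_scaling abs_rho_step_le abs_rho_sub_rho_le_of_blockMapIter_eq exp_two_le)
open B9Eq346AgmonGradientZd (sq_sum_covDerivFwd_GpZd_le)
open B9Thm31FlatPoincareCoerciveZd (cover_cubeLamS)
open B9Thm31GpAgmonDecayFlatCubeZd (sum_ite_eq_of_fullBlockGeometry)
open B9Thm31LevelPoincareCoerciveZd (sum_mass_le_formE_deltaPrimeADom_one_cubeMember)
open LatticeNorms (linfDist)

export B7Prop1Explicit (Site)

variable {d : ℕ} {𝔸 : Type*} [CStarAlgebra 𝔸]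

/-! ## §1  The gradient of the kernel under an exponential weight -/

section Exponential

variable (L : ℕ) (U₀ : Site d → Fin d → 𝔸ˣ) (η : ℝ) (τ : 𝔸 →ₗ[ℂ] ℂ) [FiniteDimensional ℝ 𝔸]
  (hτp : ∀ a : 𝔸, a ≠ 0 → 0 < (τ (star a * a)).re) (m : ℕ) (a : ℕ → ℝ) (Λ : ℕ → Finset (Site d)) (s : Finset (Site d))

/-- ★★ **THE COVARIANT GRADIENT OF `G′(U₀)δ_y w` UNDER AN EXPONENTIAL WEIGHT.**  Data as in FILE 3's `fnorm_GpZd_single_le_exp_of_levelCoercive` (unitary `U₀` with unitary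
averaged transporters, `a ≥ 0`, displayed coercivity `hco` with `c₀ > 0`, `M ≥ 0`, `0 ≤ θ < 1`; `ρ` with bond increments `≤ ℓ` and block radii `σ_j`; `κ ≥ 0` in the window
`hwin`), `y ∈ Ω₀`, a direction `μ` and a site `x` with `M_{x+e_μ}, M_y > 0`.  THEN
`|(D^η_{U₀,μ}G′(U₀)δ_y w)(x)|²_τ ≤ e^{2κℓ}·e^{−2κ(ρ(x)−ρ(y))}·(2∕((1−θ)²c₀M_y) + 2η⁻²(e^{κℓ}−1)²∕(((1−θ)c₀)²M_{x+e_μ}M_y))·|w|²_τ`.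
[cite: Balaban1985BackgroundPropagators, Thm 3.1 p.397, (3.42) p.397, (3.46) p.398, (3.24) p.394; Agmon1982, Thm 1.5 p.19] -/
theorem sq_fnorm_covDerivFwd_GpZd_single_le_exp_of_levelCoercive [NeZero L] (hd : 0 < d) (hη : η ≠ 0) (hτt : ∀ a b : 𝔸, τ (a * b) = τ (b * a))
    (hτs : ∀ a : 𝔸, τ (star a) = starRingEnd ℂ (τ a)) (hU : ∀ (x : Site d) (κ : Fin d), U₀ x κ ∈ unitaryUnits 𝔸)
    (hT : ∀ j', j' < m → ∀ z y : Site d, bgT L U₀ j' z y ∈ unitaryUnits 𝔸) (ha : ∀ j, 0 ≤ a j)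
    {c₀ θ : ℝ} (hc₀ : 0 < c₀) (hθ0 : 0 ≤ θ) (hθ1 : θ < 1) {M : Site d → ℝ} (hM0 : ∀ z ∈ s, 0 ≤ M z)
    (hco : ∀ Φ : suppSub (𝔸 := 𝔸) s, c₀ * ∑ z ∈ s, M z * fnorm τ ((Φ : Site d → 𝔸) z) ^ 2 ≤ formE τ s Φ (deltaPrimeADom L U₀ η τ hτp m a Λ s Φ))
    {κ ℓ : ℝ} (hκ : 0 ≤ κ) {σ : ℕ → ℝ} (hσ : ∀ j, 0 ≤ σ j) {ρ : Site d → ℝ} {rref : ℕ → Site d → ℝ}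
    (hlip : ∀ (z : Site d) (μ : Fin d), |ρ (z + e μ) - ρ z| ≤ ℓ)
    (hblk : ∀ j ∈ Finset.range (m + 1), ∀ y ∈ Λ j, ∀ x ∈ s, blockMapIter L j x = y → |ρ x - rref j y| ≤ σ j)
    (hwin : ∀ z ∈ s, 6 * d * (η⁻¹) ^ 2 * (Real.cosh (κ * ℓ) - 1) +
      ∑ j ∈ Finset.range (m + 1), (if blockMapIter L j z ∈ Λ j then a j * (Real.exp (2 * κ * σ j) - 1) * (((L : ℝ) ^ d)⁻¹) ^ j else 0) ≤ θ * c₀ * M z)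
    {y : Site d} (hy : y ∈ s) (w : 𝔸) (μ : Fin d) {x : Site d} (hMx : 0 < M (x + e μ)) (hMy : 0 < M y) :
    fnorm τ (covDerivFwd η U₀ μ (GpZd L U₀ η τ hτp m a Λ s hd hη hτt hτs hU ha (restrictSite s (single y w)) : Site d → 𝔸) x) ^ 2 ≤
      Real.exp (2 * (κ * ℓ)) * Real.exp (-(2 * (κ * (ρ x - ρ y)))) *
        (2 / ((1 - θ) ^ 2 * c₀ * M y) + 2 * ((η⁻¹) ^ 2 * (Real.exp (κ * ℓ) - 1) ^ 2 / (((1 - θ) * c₀) ^ 2 * M (x + e μ) * M y))) *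
          fnorm τ w ^ 2 := by
  classical
  -- the weight `ω = e^{κ(ρ − ρ(y))}`, its block references and oscillation constants (as in FILE 3)
  set ρ' : Site d → ℝ := fun z => ρ z - ρ y with hρ'
  set ω : Site d → ℝ := fun z => Real.exp (κ * ρ' z) with hω
  have hωpos : ∀ z, 0 < ω z := fun z => Real.exp_pos _
  have hωy : ω y = 1 := by simp [hω, hρ']
  set wref : ℕ → Site d → ℝ := fun j y' => Real.exp (κ * (rref j y' - ρ y)) with hwref
  have hwrefpos : ∀ j y', 0 < wref j y' := fun j y' => Real.exp_pos _
  set δ : ℕ → ℝ := fun j => Real.exp (κ * σ j) - 1 with hδ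
  have hδ0 : ∀ j, 0 ≤ δ j := fun j => by
    have h1 := Real.add_one_le_exp (κ * σ j)
    have h2 : 0 ≤ κ * σ j := mul_nonneg hκ (hσ j)
    show 0 ≤ Real.exp (κ * σ j) - 1
    linarith
  have hosc : ∀ j ∈ Finset.range (m + 1), ∀ y' ∈ Λ j, ∀ x' ∈ s, blockMapIter L j x' = y' →
      |ω x' / wref j y' - 1| ≤ δ j ∧ |wref j y' / ω x' - 1| ≤ δ j := by
    intro j hj y' hy' x' hx' hxy
    have hb := hblk j hj y' hy' x' hx' hxy
    constructor
    · show |Real.exp (κ * (ρ x' - ρ y)) / Real.exp (κ * (rref j y' - ρ y)) - 1| ≤ Real.exp (κ * σ j) - 1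
      refine abs_exp_div_exp_sub_one_le hκ ?_
      rw [show ρ x' - ρ y - (rref j y' - ρ y) = ρ x' - rref j y' by ring]
      exact hb
    · show |Real.exp (κ * (rref j y' - ρ y)) / Real.exp (κ * (ρ x' - ρ y)) - 1| ≤ Real.exp (κ * σ j) - 1
      refine abs_exp_div_exp_sub_one_le hκ ?_
      rw [show rref j y' - ρ y - (ρ x' - ρ y) = -(ρ x' - rref j y') by ring, abs_neg]
      exact hb
  have hlip' : ∀ (z : Site d) (ν : Fin d), |ρ' (z + e ν) - ρ' z| ≤ ℓ := fun z ν => by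
    show |ρ (z + e ν) - ρ y - (ρ z - ρ y)| ≤ ℓ
    rw [show ρ (z + e ν) - ρ y - (ρ z - ρ y) = ρ (z + e ν) - ρ z by ring]; exact hlip z ν
  have hJ : ∀ z ∈ s, ((η⁻¹) ^ 2 * ∑ ν : Fin d, (5 / 2 * bondRatio ω (z - e ν) ν + 1 / 2 * bondRatio ω z ν)) +
      ∑ j ∈ Finset.range (m + 1),
        (if blockMapIter L j z ∈ Λ j then a j * (δ j + δ j + δ j * δ j) * (((L : ℝ) ^ d)⁻¹) ^ j else 0) ≤ θ * c₀ * M z := by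
    intro z hz
    refine le_trans (add_le_add ?_ (le_of_eq ?_)) (hwin z hz)
    · have hr : ∀ (z : Site d) (ν : Fin d), bondRatio ω z ν ≤ 2 * (Real.cosh (κ * ℓ) - 1) := fun z ν =>
        bondRatio_exp_le hκ (hlip' z ν)
      have hsum : ∑ ν : Fin d, (5 / 2 * bondRatio ω (z - e ν) ν + 1 / 2 * bondRatio ω z ν) ≤ ∑ _ν : Fin d, 6 * (Real.cosh (κ * ℓ) - 1) := by
        refine Finset.sum_le_sum fun ν _ => ?_
        have h1 := hr (z - e ν) ν
        have h2 := hr z ν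
        linarith
      rw [Finset.sum_const, Finset.card_univ, Fintype.card_fin, nsmul_eq_mul] at hsum
      calc (η⁻¹) ^ 2 * ∑ ν : Fin d, (5 / 2 * bondRatio ω (z - e ν) ν + 1 / 2 * bondRatio ω z ν)
          ≤ (η⁻¹) ^ 2 * ((d : ℝ) * (6 * (Real.cosh (κ * ℓ) - 1))) := mul_le_mul_of_nonneg_left hsum (sq_nonneg _)
        _ = 6 * d * (η⁻¹) ^ 2 * (Real.cosh (κ * ℓ) - 1) := by ring
    · refine Finset.sum_congr rfl fun j _ => ?_
      by_cases hzj : blockMapIter L j z ∈ Λ j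
      · simp only [hzj, if_true, hδ, two_eps_eq]
      · simp only [hzj, if_false]
  -- the one-site data for FILE 9's tail gradient bound: `A = {x}`, `B = {y}`
  have hℓ0 : 0 ≤ ℓ := (abs_nonneg _).trans (hlip x μ)
  have hκℓ : 0 ≤ κ * ℓ := mul_nonneg hκ hℓ0
  set W : ℝ := ω x * Real.exp (-(κ * ℓ)) with hW
  have hWpos : 0 < W := mul_pos (hωpos x) (Real.exp_pos _)
  set r : ℝ := Real.exp (κ * ℓ) - 1 with hr
  have hr0 : 0 ≤ r := by have := Real.add_one_le_exp (κ * ℓ); rw [hr]; linarith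
  have hΨcoe : (restrictSite s (single y w) : Site d → 𝔸) = single y w := restrictSite_single_coe hy w
  have hΨB : ∀ z, z ∉ ({y} : Finset (Site d)) → (restrictSite s (single y w) : Site d → 𝔸) z = 0 := fun z hz => by
    rw [hΨcoe, single_apply_of_ne (fun h => hz (Finset.mem_singleton.2 h))]
  have hmA' : ∀ z ∈ ({x} : Finset (Site d)).image (fun x' => x' + e μ), M (x + e μ) ≤ M z := fun z hz => by
    rw [Finset.image_singleton, Finset.mem_singleton] at hz
    rw [hz]
  have hmB' : ∀ z ∈ ({y} : Finset (Site d)), M y ≤ M z := fun z hz => by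
    rw [Finset.mem_singleton] at hz; rw [hz]
  have hWA : ∀ z ∈ ({x} : Finset (Site d)), W ≤ ω z := fun z hz => by
    rw [Finset.mem_singleton] at hz
    rw [hz, hW]
    have h1 : Real.exp (-(κ * ℓ)) ≤ 1 := Real.exp_le_one_iff.2 (by linarith)
    have := mul_le_mul_of_nonneg_left h1 (hωpos x).le
    simpa using this
  have hWA' : ∀ z ∈ ({x} : Finset (Site d)).image (fun x' => x' + e μ), W ≤ ω z := fun z hz => by
    rw [Finset.image_singleton, Finset.mem_singleton] at hz
    rw [hz, hW]
    show Real.exp (κ * (ρ x - ρ y)) * Real.exp (-(κ * ℓ)) ≤ Real.exp (κ * (ρ (x + e μ) - ρ y))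
    rw [← Real.exp_add]
    refine Real.exp_le_exp.2 ?_
    have h := (abs_le.1 (hlip x μ)).1
    nlinarith [mul_le_mul_of_nonneg_left h hκ]
  have hωB : ∀ z ∈ ({y} : Finset (Site d)), ω z = 1 := fun z hz => by
    rw [Finset.mem_singleton] at hz; rw [hz]; exact hωy
  have hratio : ∀ x' ∈ ({x} : Finset (Site d)), |ω (x' + e μ) / ω x' - 1| ≤ r := fun x' hx' => by
    show |Real.exp (κ * ρ' (x' + e μ)) / Real.exp (κ * ρ' x') - 1| ≤ Real.exp (κ * ℓ) - 1
    exact abs_exp_div_exp_sub_one_le hκ (hlip' x' μ)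
  have hmain := sq_sum_covDerivFwd_GpZd_le L U₀ η τ hτp m a Λ s hd hη hτt hτs hU hT ha hc₀ hθ0 hθ1 hM0 hco hωpos hwrefpos hδ0 hδ0
    hosc hJ hMx hMy hWpos hr0 μ hmA' hmB' hWA hWA' hωB hratio hΨB
  rw [Finset.sum_singleton, formE_single_self hτp hy w] at hmain
  refine hmain.trans (le_of_eq ?_)
  -- algebra: `1∕W² = e^{2κℓ}e^{−2κ(ρ x − ρ y)}`
  have hWsq : 1 / W ^ 2 = Real.exp (2 * (κ * ℓ)) * Real.exp (-(2 * (κ * (ρ x - ρ y)))) := by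
    rw [hW]
    show 1 / (Real.exp (κ * (ρ x - ρ y)) * Real.exp (-(κ * ℓ))) ^ 2 = _
    rw [← Real.exp_add, ← Real.exp_nat_mul, one_div, ← Real.exp_neg, ← Real.exp_add]
    congr 1; push_cast; ring
  have hθ' : (1 - θ) ≠ 0 := by intro h; linarith
  have hc0' : c₀ ≠ 0 := hc₀.ne'
  have hMx' : M (x + e μ) ≠ 0 := hMx.ne'
  have hMy' : M y ≠ 0 := hMy.ne'
  have hW' : W ≠ 0 := hWpos.ne'
  have key : 2 * (1 / W ^ 2) * (fnorm τ w ^ 2 / ((1 - θ) ^ 2 * c₀ * M y)) +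
      2 * ((η⁻¹) ^ 2 * r ^ 2 * (fnorm τ w ^ 2 / (((1 - θ) * c₀) ^ 2 * M (x + e μ) * M y * W ^ 2))) =
      (1 / W ^ 2) * (2 / ((1 - θ) ^ 2 * c₀ * M y) + 2 * ((η⁻¹) ^ 2 * r ^ 2 / (((1 - θ) * c₀) ^ 2 * M (x + e μ) * M y))) * fnorm τ w ^ 2 := by
    field_simp
  rw [key, hWsq]

end Exponential

/-! ## §2  The coarsest scale: explicit member-uniform constants -/

section Coarse

variable (L : ℕ) (U₀ : Site d → Fin d → 𝔸ˣ) (η : ℝ) (τ : 𝔸 →ₗ[ℂ] ℂ) [FiniteDimensional ℝ 𝔸]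
  (hτp : ∀ a : 𝔸, a ≠ 0 → 0 < (τ (star a * a)).re) (m : ℕ) (a : ℕ → ℝ) (Λ : ℕ → Finset (Site d)) (s : Finset (Site d))
set_option maxHeartbeats 400000 in
/-- ★★★ **[B9] THM 3.1's (3.42), n = 1 SHAPE (SQUARED), FOR THE GENUINE `G′(U₀)` AT THE `ℤᵈ` CARRIER, EXPLICIT MEMBER-UNIFORM CONSTANTS AT THE COARSEST SCALE.**
`L ≥ 1`; `U₀` unitary with unitary averaged transporters below level `m`; `a ≥ 0`; `0 < d`, `η ≠ 0`; `τ` tracial Hermitian faithful; DISPLAYED coercivity `hco` (`c₀ > 0`,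
`M ≥ 0`), scaling slots `η⁻²(Lᵐ)⁻² ≤ B·M(z)`, `Σ_{j≤m}𝟙[yʲ(z)∈Λ_j]a_j(Lᵈ)^{−j} ≤ A·M(z)` on `Ω₀` (`B > 0`); `0 ≤ θ < 1`; `0 ≤ κ ≤ 1` with `κ(6dB + 15A) ≤ θc₀`.
THEN for `y ∈ Ω₀`, every direction `μ` and every `x` with `x + e_μ ∈ Ω₀`:
`|(D^η_{U₀,μ}G′(U₀)δ_y w)(x)|²_τ ≤ 16B(c₀ + 9κ²B)∕((1−θ)c₀)²·(ηLᵐ)²·e^{−2κL^{−m}|x−y|_∞}·|w|²_τ`.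
[cite: Balaban1985BackgroundPropagators, Thm 3.1 p.397, (3.42) p.397, (3.24) p.394, Thm 3.11 p.416; Agmon1982, Thm 1.5 p.19] -/
theorem sq_fnorm_covDerivFwd_GpZd_single_le_exp_coarse [NeZero L] (hd : 0 < d) (hη : η ≠ 0) (hL : 1 ≤ L) (hτt : ∀ a b : 𝔸, τ (a * b) = τ (b * a))
    (hτs : ∀ a : 𝔸, τ (star a) = starRingEnd ℂ (τ a)) (hU : ∀ (x : Site d) (κ : Fin d), U₀ x κ ∈ unitaryUnits 𝔸)
    (hT : ∀ j', j' < m → ∀ z y : Site d, bgT L U₀ j' z y ∈ unitaryUnits 𝔸) (ha : ∀ j, 0 ≤ a j)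
    {c₀ θ : ℝ} (hc₀ : 0 < c₀) (hθ0 : 0 ≤ θ) (hθ1 : θ < 1) {M : Site d → ℝ} (hM0 : ∀ z ∈ s, 0 ≤ M z)
    (hco : ∀ Φ : suppSub (𝔸 := 𝔸) s, c₀ * ∑ z ∈ s, M z * fnorm τ ((Φ : Site d → 𝔸) z) ^ 2 ≤ formE τ s Φ (deltaPrimeADom L U₀ η τ hτp m a Λ s Φ))
    {A B κ : ℝ} (hBpos : 0 < B) (hκ0 : 0 ≤ κ) (hκ1 : κ ≤ 1) (hκ : κ * (6 * d * B + 15 * A) ≤ θ * c₀)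
    (hB : ∀ z ∈ s, (η⁻¹) ^ 2 * (((L : ℝ) ^ m)⁻¹) ^ 2 ≤ B * M z)
    (hA : ∀ z ∈ s, ∑ j ∈ Finset.range (m + 1), (if blockMapIter L j z ∈ Λ j then a j * (((L : ℝ) ^ d)⁻¹) ^ j else 0) ≤ A * M z)
    {y : Site d} (hy : y ∈ s) (w : 𝔸) (μ : Fin d) {x : Site d} (hx : x + e μ ∈ s) :
    fnorm τ (covDerivFwd η U₀ μ (GpZd L U₀ η τ hτp m a Λ s hd hη hτt hτs hU ha (restrictSite s (single y w)) : Site d → 𝔸) x) ^ 2 ≤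
      16 * B * (c₀ + 9 * κ ^ 2 * B) / ((1 - θ) * c₀) ^ 2 * (η * (L : ℝ) ^ m) ^ 2 *
        Real.exp (-(2 * (κ * (((L : ℝ) ^ m)⁻¹ * ((linfDist x y : ℕ) : ℝ))))) * fnorm τ w ^ 2 := by
  classical
  have hL0 : (0 : ℝ) < L := by exact_mod_cast hL
  have hLm : 0 < (L : ℝ) ^ m := by positivity
  have hLm1 : 1 ≤ (L : ℝ) ^ m := one_le_pow₀ (by exact_mod_cast hL)
  have hℓ1 : ((L : ℝ) ^ m)⁻¹ ≤ 1 := inv_le_one_of_one_le₀ hLm1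
  have hℓ0 : 0 ≤ ((L : ℝ) ^ m)⁻¹ := by positivity
  -- the weight data: `ρ = L^{−m}|· − y|_∞`, `ℓ = L^{−m}`, `σ ≡ 1`, references by choice (as in FILE 4)
  set ρ : Site d → ℝ := fun z => ((L : ℝ) ^ m)⁻¹ * ((linfDist z y : ℕ) : ℝ) with hρ
  set rref : ℕ → Site d → ℝ := fun j y' => if h : ∃ x₀ ∈ s, blockMapIter L j x₀ = y' then ρ (Classical.choose h) else 0 with hrref
  have hlip : ∀ (z : Site d) (ν : Fin d), |ρ (z + e ν) - ρ z| ≤ ((L : ℝ) ^ m)⁻¹ := fun z ν => abs_rho_step_le (d := d) L m hL y z ν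
  have hblk : ∀ j ∈ Finset.range (m + 1), ∀ y' ∈ Λ j, ∀ x' ∈ s, blockMapIter L j x' = y' → |ρ x' - rref j y'| ≤ (fun _ : ℕ => (1 : ℝ)) j := by
    intro j hj y' _ x' hx' hxy
    have hex : ∃ x₀ ∈ s, blockMapIter L j x₀ = y' := ⟨x', hx', hxy⟩
    have hr : rref j y' = ρ (Classical.choose hex) := by simp only [hrref, dif_pos hex]
    rw [hr]
    have hspec := Classical.choose_spec hex
    exact abs_rho_sub_rho_le_of_blockMapIter_eq (d := d) L m hL (by have := Finset.mem_range.1 hj; omega) y (hxy.trans hspec.2.symm)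
  have hwin : ∀ z ∈ s, 6 * d * (η⁻¹) ^ 2 * (Real.cosh (κ * ((L : ℝ) ^ m)⁻¹) - 1) +
      ∑ j ∈ Finset.range (m + 1), (if blockMapIter L j z ∈ Λ j then a j * (Real.exp (2 * κ * (fun _ : ℕ => (1 : ℝ)) j) - 1) * (((L : ℝ) ^ d)⁻¹) ^ j else 0)
        ≤ θ * c₀ * M z := fun z hz => window_of_scaling (d := d) hL ha Λ hM0 hκ0 hκ1 hκ hB hA hz
  -- mass floor `μ₀ = η⁻²L^{−2m}∕B ≤ M` on `Ω₀`
  set μ₀ : ℝ := (η⁻¹) ^ 2 * (((L : ℝ) ^ m)⁻¹) ^ 2 / B with hμ₀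
  have hη2 : 0 < (η⁻¹) ^ 2 := by positivity
  have hμ₀pos : 0 < μ₀ := by positivity
  have hfloor : ∀ z ∈ s, μ₀ ≤ M z := fun z hz => by
    rw [hμ₀, div_le_iff₀ hBpos]; linarith [hB z hz]
  have hMx : 0 < M (x + e μ) := hμ₀pos.trans_le (hfloor _ hx)
  have hMy : 0 < M y := hμ₀pos.trans_le (hfloor y hy)
  have hmain := sq_fnorm_covDerivFwd_GpZd_single_le_exp_of_levelCoercive L U₀ η τ hτp m a Λ s hd hη hτt hτs hU hT ha hc₀ hθ0 hθ1 hM0 hco hκ0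
    (σ := fun _ => (1 : ℝ)) (fun _ => zero_le_one) hlip hblk hwin hy w μ hMx hMy
  have hρy : ρ y = 0 := by simp [hρ]
  rw [hρy, sub_zero] at hmain
  refine hmain.trans ?_
  -- the three elementary estimates
  have hθ' : 0 < 1 - θ := by linarith
  have hκℓ0 : 0 ≤ κ * ((L : ℝ) ^ m)⁻¹ := mul_nonneg hκ0 hℓ0
  have hκℓ1 : κ * ((L : ℝ) ^ m)⁻¹ ≤ 1 := by nlinarith
  have hE2 : Real.exp (2 * (κ * ((L : ℝ) ^ m)⁻¹)) ≤ 8 := by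
    have := Real.exp_le_exp.2 (show 2 * (κ * ((L : ℝ) ^ m)⁻¹) ≤ 2 by nlinarith)
    linarith [exp_two_le]
  -- `e^{t} − 1 ≤ 3t` for `0 ≤ t ≤ 1` (from `1 − t ≤ e^{−t}` and `e ≤ 3`; the tree's `Literature.NumberTheory.Sieve.exp_sub_one_le_three_mul`, inlined)
  have hr3 : Real.exp (κ * ((L : ℝ) ^ m)⁻¹) - 1 ≤ 3 * (κ * ((L : ℝ) ^ m)⁻¹) := by
    have he : Real.exp (κ * ((L : ℝ) ^ m)⁻¹) ≤ 3 := by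
      have h3 : Real.exp 1 < 3 := lt_trans Real.exp_one_lt_d9 (by norm_num)
      exact le_trans (Real.exp_le_exp.2 hκℓ1) h3.le
    have h := Real.add_one_le_exp (-(κ * ((L : ℝ) ^ m)⁻¹))
    have hprod : Real.exp (κ * ((L : ℝ) ^ m)⁻¹) * Real.exp (-(κ * ((L : ℝ) ^ m)⁻¹)) = 1 := by
      rw [← Real.exp_add, add_neg_cancel, Real.exp_zero]
    have hpos := Real.exp_pos (κ * ((L : ℝ) ^ m)⁻¹)
    nlinarith [mul_le_mul_of_nonneg_left h hpos.le]
  have hr0 : 0 ≤ Real.exp (κ * ((L : ℝ) ^ m)⁻¹) - 1 := by have := Real.add_one_le_exp (κ * ((L : ℝ) ^ m)⁻¹); linarith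
  -- `1∕M_y ≤ B(ηLᵐ)²`, `η⁻²(e^{κℓ}−1)²∕M_{x+e} ≤ 9κ²B`
  have hMyinv : 1 / M y ≤ B * (η * (L : ℝ) ^ m) ^ 2 := by
    rw [div_le_iff₀ hMy]
    have h := hfloor y hy
    have hid : B * (η * (L : ℝ) ^ m) ^ 2 * μ₀ = 1 := by rw [hμ₀]; field_simp
    nlinarith [mul_le_mul_of_nonneg_left h (show 0 ≤ B * (η * (L : ℝ) ^ m) ^ 2 by positivity)]
  have hdef : (η⁻¹) ^ 2 * (Real.exp (κ * ((L : ℝ) ^ m)⁻¹) - 1) ^ 2 / M (x + e μ) ≤ 9 * κ ^ 2 * B := by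
    rw [div_le_iff₀ hMx]
    have h := hfloor _ hx
    have hsq : (Real.exp (κ * ((L : ℝ) ^ m)⁻¹) - 1) ^ 2 ≤ (3 * (κ * ((L : ℝ) ^ m)⁻¹)) ^ 2 := pow_le_pow_left₀ hr0 hr3 2
    have hid : 9 * κ ^ 2 * B * μ₀ = (η⁻¹) ^ 2 * (3 * (κ * ((L : ℝ) ^ m)⁻¹)) ^ 2 := by rw [hμ₀]; field_simp; ring
    calc (η⁻¹) ^ 2 * (Real.exp (κ * ((L : ℝ) ^ m)⁻¹) - 1) ^ 2 ≤ (η⁻¹) ^ 2 * (3 * (κ * ((L : ℝ) ^ m)⁻¹)) ^ 2 :=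
          mul_le_mul_of_nonneg_left hsq hη2.le
      _ = 9 * κ ^ 2 * B * μ₀ := hid.symm
      _ ≤ 9 * κ ^ 2 * B * M (x + e μ) := mul_le_mul_of_nonneg_left h (by positivity)
  -- assemble
  have hE := Real.exp_pos (-(2 * (κ * (((L : ℝ) ^ m)⁻¹ * ((linfDist x y : ℕ) : ℝ)))))
  have hw0 : 0 ≤ fnorm τ w ^ 2 := sq_nonneg _
  have hterm1 : 2 / ((1 - θ) ^ 2 * c₀ * M y) ≤ 2 / ((1 - θ) ^ 2 * c₀) * (B * (η * (L : ℝ) ^ m) ^ 2) := by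
    rw [show 2 / ((1 - θ) ^ 2 * c₀ * M y) = 2 / ((1 - θ) ^ 2 * c₀) * (1 / M y) by field_simp]
    exact mul_le_mul_of_nonneg_left hMyinv (by positivity)
  have hterm2 : 2 * ((η⁻¹) ^ 2 * (Real.exp (κ * ((L : ℝ) ^ m)⁻¹) - 1) ^ 2 / (((1 - θ) * c₀) ^ 2 * M (x + e μ) * M y)) ≤
      2 * ((9 * κ ^ 2 * B) * (B * (η * (L : ℝ) ^ m) ^ 2) / ((1 - θ) * c₀) ^ 2) := by
    have hsplit : (η⁻¹) ^ 2 * (Real.exp (κ * ((L : ℝ) ^ m)⁻¹) - 1) ^ 2 / (((1 - θ) * c₀) ^ 2 * M (x + e μ) * M y) =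
        ((η⁻¹) ^ 2 * (Real.exp (κ * ((L : ℝ) ^ m)⁻¹) - 1) ^ 2 / M (x + e μ)) * (1 / M y) / ((1 - θ) * c₀) ^ 2 := by
      field_simp
    rw [hsplit]
    have hnum : ((η⁻¹) ^ 2 * (Real.exp (κ * ((L : ℝ) ^ m)⁻¹) - 1) ^ 2 / M (x + e μ)) * (1 / M y) ≤ (9 * κ ^ 2 * B) * (B * (η * (L : ℝ) ^ m) ^ 2) :=
      mul_le_mul hdef hMyinv (by positivity) (by positivity)
    gcongr
  have hsum := add_le_add hterm1 hterm2
  calc Real.exp (2 * (κ * ((L : ℝ) ^ m)⁻¹)) * Real.exp (-(2 * (κ * ρ x))) *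
        (2 / ((1 - θ) ^ 2 * c₀ * M y) + 2 * ((η⁻¹) ^ 2 * (Real.exp (κ * ((L : ℝ) ^ m)⁻¹) - 1) ^ 2 / (((1 - θ) * c₀) ^ 2 * M (x + e μ) * M y))) * fnorm τ w ^ 2
      ≤ 8 * Real.exp (-(2 * (κ * ρ x))) *
        (2 / ((1 - θ) ^ 2 * c₀) * (B * (η * (L : ℝ) ^ m) ^ 2) + 2 * ((9 * κ ^ 2 * B) * (B * (η * (L : ℝ) ^ m) ^ 2) / ((1 - θ) * c₀) ^ 2)) * fnorm τ w ^ 2 := by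
        have hpos1 : 0 ≤ 2 / ((1 - θ) ^ 2 * c₀ * M y) + 2 * ((η⁻¹) ^ 2 * (Real.exp (κ * ((L : ℝ) ^ m)⁻¹) - 1) ^ 2 / (((1 - θ) * c₀) ^ 2 * M (x + e μ) * M y)) := by
          positivity
        gcongr
    _ = 16 * B * (c₀ + 9 * κ ^ 2 * B) / ((1 - θ) * c₀) ^ 2 * (η * (L : ℝ) ^ m) ^ 2 * Real.exp (-(2 * (κ * ρ x))) * fnorm τ w ^ 2 := by
        field_simp
        ring

/-- ★★★ **[B9] THM 3.1's (3.42), n = 1 SHAPE — THE POINTWISE GRADIENT BOUND**: under the data of `sq_fnorm_covDerivFwd_GpZd_single_le_exp_coarse` and `η > 0`,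
`|(D^η_{U₀,μ}G′(U₀)δ_y w)(x)|_τ ≤ 4√(B(c₀ + 9κ²B))∕((1−θ)c₀)·(ηLᵐ)·e^{−κL^{−m}|x−y|_∞}·|w|_τ` — print's `B₀·Lʲη·e^{−δ₀d(y,y′)}|λ|` at the coarsest scale `j = m` with
`B₀ = 4√(B(c₀ + 9κ²B))∕((1−θ)c₀)`, `δ₀ = κ`; no constant depends on `η`, `|Ω₀|` or `U₀` beyond the displayed data.
[cite: Balaban1985BackgroundPropagators, Thm 3.1 p.397, (3.42) p.397, (3.24) p.394, Thm 3.11 p.416; Agmon1982, Thm 1.5 p.19] -/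
theorem fnorm_covDerivFwd_GpZd_single_le_exp_coarse [NeZero L] (hd : 0 < d) (hη : η ≠ 0) (hL : 1 ≤ L) (hτt : ∀ a b : 𝔸, τ (a * b) = τ (b * a))
    (hτs : ∀ a : 𝔸, τ (star a) = starRingEnd ℂ (τ a)) (hU : ∀ (x : Site d) (κ : Fin d), U₀ x κ ∈ unitaryUnits 𝔸)
    (hT : ∀ j', j' < m → ∀ z y : Site d, bgT L U₀ j' z y ∈ unitaryUnits 𝔸) (ha : ∀ j, 0 ≤ a j)
    {c₀ θ : ℝ} (hc₀ : 0 < c₀) (hθ0 : 0 ≤ θ) (hθ1 : θ < 1) {M : Site d → ℝ} (hM0 : ∀ z ∈ s, 0 ≤ M z)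
    (hco : ∀ Φ : suppSub (𝔸 := 𝔸) s, c₀ * ∑ z ∈ s, M z * fnorm τ ((Φ : Site d → 𝔸) z) ^ 2 ≤ formE τ s Φ (deltaPrimeADom L U₀ η τ hτp m a Λ s Φ))
    {A B κ : ℝ} (hBpos : 0 < B) (hκ0 : 0 ≤ κ) (hκ1 : κ ≤ 1) (hκ : κ * (6 * d * B + 15 * A) ≤ θ * c₀)
    (hB : ∀ z ∈ s, (η⁻¹) ^ 2 * (((L : ℝ) ^ m)⁻¹) ^ 2 ≤ B * M z)
    (hA : ∀ z ∈ s, ∑ j ∈ Finset.range (m + 1), (if blockMapIter L j z ∈ Λ j then a j * (((L : ℝ) ^ d)⁻¹) ^ j else 0) ≤ A * M z)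
    (hηpos : 0 < η) {y : Site d} (hy : y ∈ s) (w : 𝔸) (μ : Fin d) {x : Site d} (hx : x + e μ ∈ s) :
    fnorm τ (covDerivFwd η U₀ μ (GpZd L U₀ η τ hτp m a Λ s hd hη hτt hτs hU ha (restrictSite s (single y w)) : Site d → 𝔸) x) ≤
      4 * Real.sqrt (B * (c₀ + 9 * κ ^ 2 * B)) / ((1 - θ) * c₀) * (η * (L : ℝ) ^ m) *
        Real.exp (-(κ * (((L : ℝ) ^ m)⁻¹ * ((linfDist x y : ℕ) : ℝ)))) * fnorm τ w := by
  have hsq := sq_fnorm_covDerivFwd_GpZd_single_le_exp_coarse L U₀ η τ hτp m a Λ s hd hη hL hτt hτs hU hT ha hc₀ hθ0 hθ1 hM0 hco hBpos hκ0 hκ1 hκ hB hA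
    hy w μ hx
  have hθ' : 0 < 1 - θ := by linarith
  have hBc : 0 ≤ B * (c₀ + 9 * κ ^ 2 * B) := by positivity
  set S : ℝ := Real.sqrt (B * (c₀ + 9 * κ ^ 2 * B)) with hS
  set t : ℝ := ((L : ℝ) ^ m)⁻¹ * ((linfDist x y : ℕ) : ℝ) with ht
  have hS2 : 16 * B * (c₀ + 9 * κ ^ 2 * B) = 16 * S ^ 2 := by rw [hS, Real.sq_sqrt hBc]; ring
  have hexp2 : Real.exp (-(2 * (κ * t))) = Real.exp (-(κ * t)) ^ 2 := by
    rw [← Real.exp_nat_mul]; congr 1; push_cast; ring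
  have hR2 : (4 * S / ((1 - θ) * c₀) * (η * (L : ℝ) ^ m) * Real.exp (-(κ * t)) * fnorm τ w) ^ 2 =
      16 * B * (c₀ + 9 * κ ^ 2 * B) / ((1 - θ) * c₀) ^ 2 * (η * (L : ℝ) ^ m) ^ 2 * Real.exp (-(2 * (κ * t))) * fnorm τ w ^ 2 := by
    have h1 : (1 - θ) ≠ 0 := hθ'.ne'
    have h2 : c₀ ≠ 0 := hc₀.ne'
    rw [hS2, hexp2]
    field_simp
    ring
  have hL0 : (0 : ℝ) < L := by exact_mod_cast hL
  have hpos : 0 ≤ 4 * S / ((1 - θ) * c₀) * (η * (L : ℝ) ^ m) * Real.exp (-(κ * t)) * fnorm τ w := by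
    have := fnorm_nonneg τ w
    have : 0 ≤ S := Real.sqrt_nonneg _
    positivity
  have h2 := hsq.trans (le_of_eq hR2.symm)
  exact (pow_le_pow_iff_left₀ (fnorm_nonneg τ _) hpos (by norm_num)).1 h2

end Coarse

/-! ## §3  The flat background at a cube member: the data package and the unconditional gradient bound -/

section CubeMember

variable (L : ℕ) (τ : 𝔸 →ₗ[ℂ] ℂ) [FiniteDimensional ℝ 𝔸] (hτp : ∀ a : 𝔸, a ≠ 0 → 0 < (τ (star a * a)).re)

/-- ★★ **THE FLAT CUBE-MEMBER DATA PACKAGE** (FILE 8's bookkeeping made reusable): at a cube member `i` (`i.Ω = cubeFam false L ac Mc ρc i.k`, `2 ≤ L ≤ ρc`, `m ≤ i.k`)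
with print-scaled weights `a_lo(Lᵈ)ʲ(ηLʲ)⁻² ≤ a_j ≤ a_hi(Lᵈ)ʲ(ηLʲ)⁻²` (`j ≤ m`, `a_lo > 0`), `m₈ = min{8, a_lo}`, there is a site mass `M` (namely `M(z) = m₈(ηL^{j(z)})⁻²`,
`j(z)` the level owning `z`) with: `M ≥ 0` on `□₀`; FILE 5's level-weighted coercivity `1·Σ_zM_z|Φ z|²_τ ≤ ⟨Φ, Δ′(1)Φ⟩_τ`; the scaling slots `η⁻²(Lᵐ)⁻² ≤ m₈⁻¹·M(z)` and
`Σ_{j≤m}𝟙[yʲ(z)∈Λ_j]a_j(Lᵈ)^{−j} ≤ a_hi m₈⁻¹·M(z)`; and the floor `m₈(ηLᵐ)⁻² ≤ M(z)` on `□₀`.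
[cite: Balaban1985BackgroundPropagators, (3.24) p.394, Thm 3.1 p.397; Balaban1985RegularSpaces, (1.131) p.99; Balaban1984PropagatorsII, (2.22) p.226] -/
theorem levelData_one_cubeMember [Nontrivial 𝔸] (hL : 2 ≤ L) (hτt : ∀ a b : 𝔸, τ (a * b) = τ (b * a))
    (hτs : ∀ a : 𝔸, τ (star a) = starRingEnd ℂ (τ a)) (i : ZdIdx d L) {ac : Site d} {Mc ρc : ℕ} (hΩ : i.Ω = cubeFam false L ac Mc ρc i.k)
    (hρc : L ≤ ρc) {m : ℕ} (hm : m ≤ i.k) {a : ℕ → ℝ} (ha : ∀ j, 0 ≤ a j) {a_lo a_hi : ℝ} (halo : 0 < a_lo)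
    (hlo : ∀ j ∈ Finset.range (m + 1), a_lo * ((L : ℝ) ^ d) ^ j * ((i.η * (L : ℝ) ^ j) ^ 2)⁻¹ ≤ a j)
    (hhi : ∀ j ∈ Finset.range (m + 1), a j ≤ a_hi * ((L : ℝ) ^ d) ^ j * ((i.η * (L : ℝ) ^ j) ^ 2)⁻¹) :
    ∃ M : Site d → ℝ,
      (∀ z ∈ (cubeMember_Ω0_finite i hΩ).toFinset, 0 ≤ M z) ∧
      (∀ Φ : suppSub (𝔸 := 𝔸) (cubeMember_Ω0_finite i hΩ).toFinset,
        1 * ∑ z ∈ (cubeMember_Ω0_finite i hΩ).toFinset, M z * fnorm τ ((Φ : Site d → 𝔸) z) ^ 2 ≤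
          formE τ (cubeMember_Ω0_finite i hΩ).toFinset Φ
            (deltaPrimeADom L (1 : Site d → Fin d → 𝔸ˣ) i.η τ hτp m a (fun j => (cubeLamS_finite L ac Mc ρc i.k m j).toFinset)
              (cubeMember_Ω0_finite i hΩ).toFinset Φ)) ∧
      (∀ z ∈ (cubeMember_Ω0_finite i hΩ).toFinset, (i.η⁻¹) ^ 2 * (((L : ℝ) ^ m)⁻¹) ^ 2 ≤ (min 8 a_lo)⁻¹ * M z) ∧
      (∀ z ∈ (cubeMember_Ω0_finite i hΩ).toFinset, ∑ j ∈ Finset.range (m + 1),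
        (if blockMapIter L j z ∈ (fun j => (cubeLamS_finite L ac Mc ρc i.k m j).toFinset) j then a j * (((L : ℝ) ^ d)⁻¹) ^ j else 0) ≤
          a_hi * (min 8 a_lo)⁻¹ * M z) ∧
      (∀ z ∈ (cubeMember_Ω0_finite i hΩ).toFinset, min 8 a_lo * ((i.η * (L : ℝ) ^ m) ^ 2)⁻¹ ≤ M z) := by
  classical
  haveI : NeZero L := ⟨by omega⟩
  have hL1 : 1 ≤ L := le_trans one_le_two hL
  have hL0 : (0 : ℝ) < L := by exact_mod_cast (lt_of_lt_of_le zero_lt_two hL)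
  set S := (cubeMember_Ω0_finite i hΩ).toFinset with hS
  set Λ : ℕ → Finset (Site d) := fun j => (cubeLamS_finite L ac Mc ρc i.k m j).toFinset with hΛ
  set η : ℝ := i.η with hη
  have hη0 : 0 < η := i.hη
  set m₈ : ℝ := min 8 a_lo with hm₈
  have hm₈0 : 0 < m₈ := lt_min (by norm_num) halo
  have hm₈8 : m₈ ≤ 8 := min_le_left _ _
  have hm₈lo : m₈ ≤ a_lo := min_le_right _ _
  -- geometry of the member
  have hG : FullBlockGeometry L m Λ S := fullBlockGeometry_cubeMember i hΩ hρc hm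
  have hsS : ∀ z, z ∈ S ↔ z ∈ cubeFam false L ac Mc ρc i.k 0 := fun z => by rw [hS, Set.Finite.mem_toFinset, hΩ]
  have hΛmem : ∀ j y', y' ∈ Λ j ↔ y' ∈ cubeLamS L ac Mc ρc i.k m j := fun j y' => Set.Finite.mem_toFinset _
  have hcov : ∀ z ∈ S, ∃ j ∈ Finset.range (m + 1), blockMapIter L j z ∈ Λ j := by
    intro z hz
    obtain ⟨j, hj, hmem⟩ := cover_cubeLamS hL1 ac Mc ρc ((hsS z).1 hz) (m := m)
    exact ⟨j, hj, (hΛmem j _).2 hmem⟩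
  -- the site mass: `m₈(ηL^{j(z)})⁻²` at the level owning `z`
  set M : Site d → ℝ := fun z => ∑ j ∈ Finset.range (m + 1), (if blockMapIter L j z ∈ Λ j then m₈ * ((η * (L : ℝ) ^ j) ^ 2)⁻¹ else 0) with hM
  have hMval : ∀ j₀ ∈ Finset.range (m + 1), ∀ z : Site d, blockMapIter L j₀ z ∈ Λ j₀ → M z = m₈ * ((η * (L : ℝ) ^ j₀) ^ 2)⁻¹ :=
    fun j₀ hj₀ z hz => sum_ite_eq_of_fullBlockGeometry hG hj₀ hz _
  have hM0 : ∀ z ∈ S, 0 ≤ M z := fun z _ =>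
    Finset.sum_nonneg fun j _ => by split_ifs <;> positivity
  refine ⟨M, hM0, ?_, ?_, ?_, ?_⟩
  · -- the level-weighted flat coercivity (FILE 5) with this mass
    intro Φ
    rw [one_mul]
    refine sum_mass_le_formE_deltaPrimeADom_one_cubeMember τ hτp hτt hτs hη0 ha i hΩ hρc hm (fun j hj y' hy' z hz => ?_) Φ
    rw [hMval j hj z (hz ▸ hy')]
    refine le_min ?_ ?_
    · exact mul_le_mul_of_nonneg_right hm₈8 (by positivity)
    · have h := hlo j hj
      have hLd : 0 < ((L : ℝ) ^ d) ^ j := by positivity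
      have key : m₈ * ((η * (L : ℝ) ^ j) ^ 2)⁻¹ * ((L : ℝ) ^ d) ^ j ≤ a j :=
        calc m₈ * ((η * (L : ℝ) ^ j) ^ 2)⁻¹ * ((L : ℝ) ^ d) ^ j ≤ a_lo * ((η * (L : ℝ) ^ j) ^ 2)⁻¹ * ((L : ℝ) ^ d) ^ j := by gcongr
          _ = a_lo * ((L : ℝ) ^ d) ^ j * ((η * (L : ℝ) ^ j) ^ 2)⁻¹ := by ring
          _ ≤ a j := h
      calc m₈ * ((η * (L : ℝ) ^ j) ^ 2)⁻¹ = (m₈ * ((η * (L : ℝ) ^ j) ^ 2)⁻¹ * ((L : ℝ) ^ d) ^ j) * (((L : ℝ) ^ d) ^ j)⁻¹ := by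
            rw [mul_assoc (m₈ * _), mul_inv_cancel₀ hLd.ne', mul_one]
        _ ≤ a j * (((L : ℝ) ^ d) ^ j)⁻¹ := mul_le_mul_of_nonneg_right key (by positivity)
        _ = a j * (((L : ℝ) ^ d)⁻¹) ^ j := by rw [inv_pow]
  · -- scaling slot `B = m₈⁻¹`
    intro z hz
    obtain ⟨j, hj, hzj⟩ := hcov z hz
    rw [hMval j hj z hzj]
    have hjm : j ≤ m := Nat.lt_succ_iff.1 (Finset.mem_range.1 hj)
    have hLj : (L : ℝ) ^ j ≤ (L : ℝ) ^ m := pow_le_pow_right₀ (by exact_mod_cast hL1) hjm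
    have hLj0 : 0 < (L : ℝ) ^ j := by positivity
    rw [← mul_assoc, inv_mul_cancel₀ hm₈0.ne', one_mul, mul_pow, mul_inv, inv_pow, inv_pow]
    gcongr
  · -- scaling slot `A = a_hi m₈⁻¹`
    intro z hz
    obtain ⟨j, hj, hzj⟩ := hcov z hz
    rw [sum_ite_eq_of_fullBlockGeometry hG hj hzj, hMval j hj z hzj]
    have h := hhi j hj
    have hLd : 0 < ((L : ℝ) ^ d) ^ j := by positivity
    rw [inv_pow, show a_hi * m₈⁻¹ * (m₈ * ((η * (L : ℝ) ^ j) ^ 2)⁻¹) = a_hi * ((η * (L : ℝ) ^ j) ^ 2)⁻¹ by field_simp]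
    rw [← div_eq_mul_inv (a j), div_le_iff₀ hLd]
    calc a j ≤ a_hi * ((L : ℝ) ^ d) ^ j * ((η * (L : ℝ) ^ j) ^ 2)⁻¹ := h
      _ = a_hi * ((η * (L : ℝ) ^ j) ^ 2)⁻¹ * ((L : ℝ) ^ d) ^ j := by ring
  · -- the floor `m₈(ηLᵐ)⁻² ≤ M`
    intro z hz
    obtain ⟨j, hj, hzj⟩ := hcov z hz
    rw [hMval j hj z hzj]
    have hjm : j ≤ m := Nat.lt_succ_iff.1 (Finset.mem_range.1 hj)
    have hLj : (L : ℝ) ^ j ≤ (L : ℝ) ^ m := pow_le_pow_right₀ (by exact_mod_cast hL1) hjm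
    have hLj0 : 0 < η * (L : ℝ) ^ j := by positivity
    gcongr

/-- ★★★ **[B9] THM 3.1's (3.42), n = 1 SHAPE, FOR `G′(1)` AT EVERY CUBE MEMBER — UNCONDITIONAL, MEMBER-UNIFORM EXPLICIT CONSTANTS.**  `2 ≤ L ≤ ρc`, `m ≤ i.k`,
`τ` tracial Hermitian faithful on a finite-dimensional nontrivial fibre, print-scaled weights as in `levelData_one_cubeMember`, `m₈ = min{8, a_lo}`, `0 ≤ κ ≤ 1` with
`κ(12d + 30a_hi) ≤ m₈`.  THEN for every direction `μ`, all `y ∈ □₀` and all `x` with `x + e_μ ∈ □₀`: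
`|(D^η_{1,μ}G′(1)δ_y w)(x)|_τ ≤ (10∕√m₈)·(ηLᵐ)·e^{−κL^{−m}|x−y|_∞}·|w|_τ` — print's `B₀·Lʲη·e^{−δ₀d}|λ|` at the coarsest scale with `B₀ = 10∕√m₈`, `δ₀ = κ`.
[cite: Balaban1985BackgroundPropagators, Thm 3.1 p.397, (3.42) p.397, (3.24) p.394; Balaban1985RegularSpaces, (1.131) p.99; Agmon1982, Thm 1.5 p.19] -/
theorem fnorm_covDerivFwd_GpZd_one_single_le_exp_cubeMember [Nontrivial 𝔸] (hd : 0 < d) (hL : 2 ≤ L) (hτt : ∀ a b : 𝔸, τ (a * b) = τ (b * a))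
    (hτs : ∀ a : 𝔸, τ (star a) = starRingEnd ℂ (τ a)) (i : ZdIdx d L) {ac : Site d} {Mc ρc : ℕ} (hΩ : i.Ω = cubeFam false L ac Mc ρc i.k)
    (hρc : L ≤ ρc) {m : ℕ} (hm : m ≤ i.k) {a : ℕ → ℝ} (ha : ∀ j, 0 ≤ a j) {a_lo a_hi : ℝ} (halo : 0 < a_lo)
    (hlo : ∀ j ∈ Finset.range (m + 1), a_lo * ((L : ℝ) ^ d) ^ j * ((i.η * (L : ℝ) ^ j) ^ 2)⁻¹ ≤ a j)
    (hhi : ∀ j ∈ Finset.range (m + 1), a j ≤ a_hi * ((L : ℝ) ^ d) ^ j * ((i.η * (L : ℝ) ^ j) ^ 2)⁻¹)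
    {κ : ℝ} (hκ0 : 0 ≤ κ) (hκ1 : κ ≤ 1) (hκ : κ * (12 * d + 30 * a_hi) ≤ min 8 a_lo) (μ : Fin d)
    {x y : Site d} (hx : x + e μ ∈ (cubeMember_Ω0_finite i hΩ).toFinset) (hy : y ∈ (cubeMember_Ω0_finite i hΩ).toFinset) (w : 𝔸) :
    fnorm τ (covDerivFwd i.η (1 : Site d → Fin d → 𝔸ˣ) μ
        (GpZd L (1 : Site d → Fin d → 𝔸ˣ) i.η τ hτp m a (fun j => (cubeLamS_finite L ac Mc ρc i.k m j).toFinset)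
          (cubeMember_Ω0_finite i hΩ).toFinset hd i.hη.ne' hτt hτs (fun _ _ => (unitaryUnits 𝔸).one_mem) ha
          (restrictSite (cubeMember_Ω0_finite i hΩ).toFinset (single y w)) : Site d → 𝔸) x) ≤
      10 / Real.sqrt (min 8 a_lo) * (i.η * (L : ℝ) ^ m) * Real.exp (-(κ * (((L : ℝ) ^ m)⁻¹ * ((linfDist x y : ℕ) : ℝ)))) * fnorm τ w := by
  haveI : NeZero L := ⟨by omega⟩
  have hL1 : 1 ≤ L := le_trans one_le_two hL
  have hL0 : (0 : ℝ) < L := by exact_mod_cast (lt_of_lt_of_le zero_lt_two hL)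
  have hη0 : 0 < i.η := i.hη
  set m₈ : ℝ := min 8 a_lo with hm₈
  have hm₈0 : 0 < m₈ := lt_min (by norm_num) halo
  have hm₈8 : m₈ ≤ 8 := min_le_left _ _
  have hahi0 : 0 ≤ a_hi := by
    have h0 := hlo 0 (Finset.mem_range.2 (Nat.succ_pos m))
    have h1 := hhi 0 (Finset.mem_range.2 (Nat.succ_pos m))
    have hpos : 0 < ((L : ℝ) ^ d) ^ 0 * ((i.η * (L : ℝ) ^ 0) ^ 2)⁻¹ := by positivity
    have : a_lo * ((L : ℝ) ^ d) ^ 0 * ((i.η * (L : ℝ) ^ 0) ^ 2)⁻¹ ≤ a_hi * ((L : ℝ) ^ d) ^ 0 * ((i.η * (L : ℝ) ^ 0) ^ 2)⁻¹ := h0.trans h1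
    rw [mul_assoc, mul_assoc] at this
    nlinarith [le_of_mul_le_mul_right this hpos]
  obtain ⟨M, hM0, hco, hB, hA, -⟩ := levelData_one_cubeMember L τ hτp hL hτt hτs i hΩ hρc hm ha halo hlo hhi
  have hT : ∀ j', j' < m → ∀ z y' : Site d, bgT L (1 : Site d → Fin d → 𝔸ˣ) j' z y' ∈ unitaryUnits 𝔸 := fun j' _ z y' => by
    rw [bgT_one]; exact (unitaryUnits 𝔸).one_mem
  -- the window with `θ = 1∕2`, `c₀ = 1`, `B = m₈⁻¹`, `A = a_hi m₈⁻¹`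
  have hκ' : κ * (6 * d * m₈⁻¹ + 15 * (a_hi * m₈⁻¹)) ≤ 1 / 2 * 1 := by
    have h1 : κ * (6 * d * m₈⁻¹ + 15 * (a_hi * m₈⁻¹)) = (κ * (12 * d + 30 * a_hi)) / (2 * m₈) := by
      field_simp
      ring
    rw [h1, mul_one, div_le_iff₀ (by positivity), show (1 : ℝ) / 2 * (2 * m₈) = m₈ by ring]
    exact hκ
  have hmain := fnorm_covDerivFwd_GpZd_single_le_exp_coarse L (1 : Site d → Fin d → 𝔸ˣ) i.η τ hτp m a
    (fun j => (cubeLamS_finite L ac Mc ρc i.k m j).toFinset) (cubeMember_Ω0_finite i hΩ).toFinset hd i.hη.ne' hL1 hτt hτs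
    (fun _ _ => (unitaryUnits 𝔸).one_mem) hT ha one_pos (by norm_num : (0 : ℝ) ≤ 1 / 2) (by norm_num : (1 : ℝ) / 2 < 1) hM0 hco
    (inv_pos.2 hm₈0) hκ0 hκ1 hκ' hB hA hη0 hy w μ hx
  refine hmain.trans ?_
  -- the amplitude: `4√(m₈⁻¹(1 + 9κ²m₈⁻¹))∕(1∕2) ≤ 10∕√m₈` since `9κ²m₈⁻¹ ≤ 9∕16`
  have hκm : 12 * κ ≤ m₈ := by
    have h12 : (12 : ℝ) ≤ 12 * d + 30 * a_hi := by
      have hd1 : (1 : ℝ) ≤ d := by exact_mod_cast hd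
      nlinarith
    nlinarith [mul_le_mul_of_nonneg_left h12 hκ0]
  have hX : m₈⁻¹ * (1 + 9 * κ ^ 2 * m₈⁻¹) ≤ 25 / 16 * m₈⁻¹ := by
    have hinv : 0 < m₈⁻¹ := inv_pos.2 hm₈0
    have h9 : 9 * κ ^ 2 * m₈⁻¹ ≤ 9 / 16 := by
      rw [show 9 * κ ^ 2 * m₈⁻¹ = 9 * κ ^ 2 / m₈ by ring, div_le_iff₀ hm₈0]
      nlinarith
    nlinarith
  have hsqrt : Real.sqrt (m₈⁻¹ * (1 + 9 * κ ^ 2 * m₈⁻¹)) ≤ 5 / 4 * (Real.sqrt m₈)⁻¹ := by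
    refine (Real.sqrt_le_sqrt hX).trans (le_of_eq ?_)
    rw [Real.sqrt_mul (by norm_num), Real.sqrt_inv, show (25 / 16 : ℝ) = (5 / 4) ^ 2 by norm_num, Real.sqrt_sq (by norm_num)]
  have hE := Real.exp_pos (-(κ * (((L : ℝ) ^ m)⁻¹ * ((linfDist x y : ℕ) : ℝ))))
  have hw0 := fnorm_nonneg τ w
  have hηL : 0 < i.η * (L : ℝ) ^ m := by positivity
  have hamp : 4 * Real.sqrt (m₈⁻¹ * (1 + 9 * κ ^ 2 * m₈⁻¹)) / ((1 - 1 / 2) * 1) ≤ 10 / Real.sqrt m₈ := by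
    rw [show ((1 : ℝ) - 1 / 2) * 1 = 1 / 2 by norm_num]
    have hs0 : 0 < Real.sqrt m₈ := Real.sqrt_pos.2 hm₈0
    calc 4 * Real.sqrt (m₈⁻¹ * (1 + 9 * κ ^ 2 * m₈⁻¹)) / (1 / 2) = 8 * Real.sqrt (m₈⁻¹ * (1 + 9 * κ ^ 2 * m₈⁻¹)) := by ring
      _ ≤ 8 * (5 / 4 * (Real.sqrt m₈)⁻¹) := mul_le_mul_of_nonneg_left hsqrt (by norm_num)
      _ = 10 / Real.sqrt m₈ := by field_simp; ring
  gcongr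

end CubeMember

end Literature.MathematicalPhysics.QuantumFieldTheory.Balaban1983to89.B9Thm31GpAgmonGradDecayZd

end
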